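import Literature.Analysis.FluidPDE.OnsagerBDSVEnergyCrossTerm
import Literature.Analysis.FluidPDE.OnsagerBDSVCorrectorBounds
import HarnessLib

/-!
# The BDSV energy estimate: the corrector terms reduced to the sup bound on `w_c` (G₂ ← Cor. 5.8)

Buckmaster–De Lellis–Székelyhidi–Vicol (BDSV), *Onsager's conjecture for admissible weak
solutions*, CPAM 72 (2019) = arXiv:1701.08678, proof of Prop. 6.2, second estimate: "Using [the
estimates of Cor. 5.8 on `w_o` and `w_c`] yields `|∫ 2w_o·w_c + |w_c|²| ≲ δ_{q+1}/(ℓλ_{q+1})`".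
Cor. 5.8 gives `‖w_o‖₀ ≤ (M/4) δ_{q+1}^{1/2}` and `‖w_c‖₀ ≲ δ_{q+1}^{1/2} ℓ⁻¹ λ_{q+1}⁻¹`, and (6.6) is
`ℓ λ_{q+1} ≥ 1`. For the named fact G₂ `BDSV.energy_correctorTerm` of `OnsagerBDSVEnergy.lean`
this file PROVES the reduction to the sup bound on the corrector:

* `BDSV.PerturbationData.norm_principalPart_le` — a sup bound `‖w_o(t,x)‖ ≤ K δ_{q+1}^{1/2}` with
  `K = 18 e^{8C_in} K_W / c₀^{1/2}` (`K_W` the bound of the Mikado profile `W` on the ball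
  `‖R‖_∞ ≤ 9e^{8C_in}(1+8C_in)` confining `R̃_{q,i}` on `supp η_i`,
  `OnsagerBDSVEnergyCrossTerm.lean`; `‖adj ∇Φ_i‖_∞ ≤ 2‖∇Φ_i‖_∞² ≤ 2e^{8C_in}`; at most one cut-off
  active) — the qualitative content of (5.30a) `‖w_o‖₀ ≤ (M/4)δ_{q+1}^{1/2}` (the sharp geometric
  constant `M` of Lemma 5.5 / Def. 5.6 is not needed for Prop. 6.2);
* `BDSV.exists_threshold_mollScale_inv_mul_freq_inv_le_one` — (6.6) `ℓ λ_{q+1} ≥ 1` for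
  `α < 2(1-β)(b-1)/3` and `a` large ("equivalent to `λ_{q+1}^{1-β} ≥ λ_q^{1-β+3α/2}`", §6.1.1);
* `BDSV.energy_correctorTerm_of_correctorPartBound : correctorPartBound → energy_correctorTerm`,
  PROVED, where `BDSV.correctorPartBound` (`OnsagerBDSVCorrectorBounds.lean`) is the tree's named
  fact for Cor. 5.8 (5.30b) on the corrector `w_c = BDSV.correctorPart` (its sup half
  `‖w_c‖₀ ≤ C δ_{q+1}^{1/2} ℓ⁻¹ λ_{q+1}⁻¹` is what is consumed):
  `|∫ 2⟪w_o,w_c⟫ + |w_c|²| ≤ 2‖w_o‖₀‖w_c‖₀ + ‖w_c‖₀² ≤ (2K C + C²) δ_{q+1} ℓ⁻¹ λ_{q+1}⁻¹` by (6.6).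

## References

* T. Buckmaster, C. De Lellis, L. Székelyhidi Jr., V. Vicol, *Onsager's conjecture for admissible
  weak solutions*, Comm. Pure Appl. Math. 72 (2019) 229–274 = arXiv:1701.08678: proof of
  Prop. 6.2 (second estimate); Cor. 5.8 (5.30a), (5.30b); §6.1.1 (6.6); Lemma 5.4.
-/

open MeasureTheory Set
open scoped NNReal ENNReal ContDiff InnerProductSpace Matrix Matrix.Norms.Elementwise

noncomputable section

namespace Literature.Analysis.FluidPDE

namespace BDSV

open FunctionSpaces FunctionSpaces.Torus

/-! ## The sup bound on the principal part `w_o` -/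

section Principal

variable {P : Params} {S : Setting} {Nbar : ℕ} {Cin C₀ c₀ : ℝ} {Cη : ℕ → ℕ → ℝ}

/-- `‖adj A‖_∞ ≤ 2 ‖A‖_∞²` for `3 × 3` matrices (each entry of the adjugate is a `2 × 2` minor).
[folklore] -/
theorem norm_adjugate_le (A : Matrix (Fin 3) (Fin 3) ℝ) : ‖A.adjugate‖ ≤ 2 * ‖A‖ ^ 2 := by
  have hA : ∀ i j, |A i j| ≤ ‖A‖ := fun i j => by
    rw [← Real.norm_eq_abs]; exact Matrix.norm_entry_le_entrywise_sup_norm A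
  have key : ∀ i j k l m n o p : Fin 3, |A i j * A k l - A m n * A o p| ≤ 2 * ‖A‖ ^ 2 := by
    intro i j k l m n o p
    calc |A i j * A k l - A m n * A o p| ≤ |A i j * A k l| + |A m n * A o p| := abs_sub _ _
      _ = |A i j| * |A k l| + |A m n| * |A o p| := by rw [abs_mul, abs_mul]
      _ ≤ ‖A‖ * ‖A‖ + ‖A‖ * ‖A‖ :=
          add_le_add (mul_le_mul (hA i j) (hA k l) (abs_nonneg _) (norm_nonneg _))
            (mul_le_mul (hA m n) (hA o p) (abs_nonneg _) (norm_nonneg _))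
      _ = 2 * ‖A‖ ^ 2 := by ring
  have key' : ∀ i j k l m n o p : Fin 3, |-(A i j * A k l) + A m n * A o p| ≤ 2 * ‖A‖ ^ 2 := by
    intro i j k l m n o p
    rw [neg_add_eq_sub]
    exact key m n o p i j k l
  rw [Matrix.norm_le_iff (by positivity), Matrix.adjugate_fin_three]
  intro i j
  rw [Real.norm_eq_abs]
  fin_cases i <;> fin_cases j <;> simp <;>
    first | exact key _ _ _ _ _ _ _ _ | exact key' _ _ _ _ _ _ _ _

/-- **Sup bound on the principal part** (the qualitative content of (5.30a)
`‖w_o‖₀ ≤ (M/4) δ_{q+1}^{1/2}`): under the standing hypotheses with `C_in ≥ 0`, `c₀ > 0`, `a ≥ 1`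
and `4δ_{q+2} ≤ δ_{q+1}λ_q^{-α}`, if the Mikado profile `W` is bounded by `K_W` on the ball
`‖R‖_∞ ≤ 9e^{8C_in}(1 + 8C_in)`, then `‖w_o(t,x)‖ ≤ (18 e^{8C_in} K_W / c₀^{1/2}) δ_{q+1}^{1/2}` on
`[0,T] × T³`. [cite: BuckmasterEtAl2018, Cor. 5.8 (5.30a)] -/
theorem PerturbationData.norm_principalPart_le (H : PerturbationHypotheses P S Nbar Cin C₀)
    (𝒟 : PerturbationData P S c₀ Cη) (𝔚 : MikadoDatum mikadoRadius) (hc₀ : 0 < c₀) (hCin : 0 ≤ Cin)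
    (ha : 1 ≤ P.a) (hb : 1 ≤ P.b) (hβ : 0 ≤ P.β) (hα : 0 ≤ P.α)
    (h4 : 4 * amp P.β P.a P.b (S.q + 2) ≤ amp P.β P.a P.b (S.q + 1) * freq P.a P.b S.q ^ (-P.α))
    {KW : ℝ} (hKW0 : 0 ≤ KW)
    (hKW : ∀ R ∈ Metric.closedBall (0 : Matrix (Fin 3) (Fin 3) ℝ)
      (9 * Real.exp (8 * Cin) * (1 + 8 * Cin)), ∀ ξ : UnitAddTorus (Fin 3), ‖𝔚.W R ξ‖ ≤ KW)
    {t : ℝ} (ht : t ∈ Icc 0 S.T) (x : UnitAddTorus (Fin 3)) :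
    ‖principalPart P S 𝔚 𝒟.cut.η 𝒟.D t x‖ ≤
      18 * Real.exp (8 * Cin) * KW / Real.sqrt c₀ * Real.sqrt (amp P.β P.a P.b (S.q + 1)) := by
  set B : ℝ := 18 * Real.exp (8 * Cin) * KW / Real.sqrt c₀ * Real.sqrt (amp P.β P.a P.b (S.q + 1))
    with hB
  have hB0 : 0 ≤ B := by positivity
  refine 𝒟.cut.norm_sum_le t x hB0 (fun i hi => by rw [sqrtRhoI, hi, zero_mul, zero_smul]) ?_ _
  intro i
  by_cases hη : 𝒟.cut.η i t x = 0
  · rw [sqrtRhoI, hη, zero_mul, zero_smul, norm_zero]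
    exact hB0
  · rw [norm_smul, Real.norm_eq_abs]
    have h1 := 𝒟.abs_sqrtRhoI_le H hc₀ ha ht i x
    have hG : ‖gradPhi 𝒟.D i t x‖ ≤ Real.exp (4 * Cin) :=
      𝒟.norm_gradPhi_le H hCin ha hb hβ hα ht hη x
    have hadj : ‖(gradPhi 𝒟.D i t x).adjugate‖ ≤ 2 * Real.exp (8 * Cin) := by
      refine (norm_adjugate_le _).trans ?_
      have h2 : ‖gradPhi 𝒟.D i t x‖ ^ 2 ≤ Real.exp (4 * Cin) ^ 2 :=
        pow_le_pow_left₀ (norm_nonneg _) hG 2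
      have h8 : Real.exp (4 * Cin) ^ 2 = Real.exp (8 * Cin) := by
        rw [← Real.exp_nat_mul]; ring_nf
      linarith
    have hRt : tildeR P S 𝒟.cut.η 𝒟.D i t x ∈
        Metric.closedBall (0 : Matrix (Fin 3) (Fin 3) ℝ)
          (9 * Real.exp (8 * Cin) * (1 + 8 * Cin)) := by
      rw [Metric.mem_closedBall, dist_zero_right]
      exact 𝒟.norm_tildeR_le H hCin ha hb hβ hα h4 ht hη x
    have hWle := hKW _ hRt (P.freqNat (S.q + 1) • phiPoint 𝒟.D i t x)
    have h2 := norm_toEuclideanLin_le (gradPhi 𝒟.D i t x).adjugate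
      (𝔚.W (tildeR P S 𝒟.cut.η 𝒟.D i t x) (P.freqNat (S.q + 1) • phiPoint 𝒟.D i t x))
    have h3 : 9 * ‖(gradPhi 𝒟.D i t x).adjugate‖ *
        ‖𝔚.W (tildeR P S 𝒟.cut.η 𝒟.D i t x) (P.freqNat (S.q + 1) • phiPoint 𝒟.D i t x)‖ ≤
        9 * (2 * Real.exp (8 * Cin)) * KW :=
      mul_le_mul (mul_le_mul_of_nonneg_left hadj (by norm_num)) hWle (norm_nonneg _) (by positivity)
    have hsq : Real.sqrt (amp P.β P.a P.b (S.q + 1) / c₀) =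
        Real.sqrt (amp P.β P.a P.b (S.q + 1)) / Real.sqrt c₀ := Real.sqrt_div (amp_pos ha _).le c₀
    calc |sqrtRhoI P S 𝒟.cut.η i t x| *
          ‖Matrix.toEuclideanLin (gradPhi 𝒟.D i t x).adjugate
            (𝔚.W (tildeR P S 𝒟.cut.η 𝒟.D i t x) (P.freqNat (S.q + 1) • phiPoint 𝒟.D i t x))‖
        ≤ Real.sqrt (amp P.β P.a P.b (S.q + 1) / c₀) * (9 * (2 * Real.exp (8 * Cin)) * KW) :=
          mul_le_mul h1 (h2.trans h3) (norm_nonneg _) (Real.sqrt_nonneg _)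
      _ = B := by rw [hB, hsq]; ring

end Principal

/-! ## (6.6): `ℓ λ_{q+1} ≥ 1` for `a` large -/

section SixSix

/-- **(6.6) `ℓ λ_{q+1} ≥ 1`**, in the form `ℓ⁻¹ λ_{q+1}⁻¹ ≤ 1`: "equivalent to
`λ_{q+1}^{1-β} ≥ λ_q^{1-β+3α/2}`, [which] follows upon taking logarithms in base `a`, choosing first
`α` so that `(b-1)(1-β) ≥ 3α`, and then `a` sufficiently large" — here for `1 ≤ b`,
`3α < 2(1-β)(b-1)` and `a` beyond a threshold. [cite: BuckmasterEtAl2018, §6.1.1 (6.6)] -/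
theorem exists_threshold_mollScale_inv_mul_freq_inv_le_one {β b α : ℝ} (hb : 1 ≤ b)
    (hαb : 3 * α < 2 * (1 - β) * (b - 1)) :
    ∃ a₁ : ℝ, 1 < a₁ ∧ ∀ a : ℝ, a₁ ≤ a → ∀ q : ℕ,
      (mollScale β α a b q)⁻¹ * (freq a b (q + 1))⁻¹ ≤ 1 := by
  -- `ℓ⁻¹ λ_{q+1}⁻¹ = λ_q^{1-β+3α/2} λ_{q+1}^{β-1}`, whose `a`-exponent is negative
  have hE : (1 - β + 3 * α / 2) + b * (β - 1) + b ^ 2 * 0 < 0 := by nlinarith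
  obtain ⟨a₁, ha₁, h⟩ := exists_freq_triple_le hb hE 1
  refine ⟨a₁, ha₁, fun a ha q => ?_⟩
  have ha1 : (1 : ℝ) ≤ a := ha₁.le.trans ha
  have hf0 := freq_pos (b := b) ha1 q
  have hf1 := freq_pos (b := b) ha1 (q + 1)
  have hq := h a ha q
  rw [one_mul, Real.rpow_zero, mul_one] at hq
  have hA : freq a b q ^ (-β) * freq a b q ^ (1 + 3 * α / 2) =
      freq a b q ^ (1 - β + 3 * α / 2) := by
    rw [← Real.rpow_add hf0]
    congr 1
    ring
  have hB : (freq a b (q + 1) ^ (-β))⁻¹ * (freq a b (q + 1))⁻¹ = freq a b (q + 1) ^ (β - 1) := by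
    rw [Real.rpow_neg hf1.le, inv_inv, Real.rpow_sub hf1, Real.rpow_one, div_eq_mul_inv]
  rw [mollScale_eq ha1, inv_div, div_eq_mul_inv, hA]
  calc freq a b q ^ (1 - β + 3 * α / 2) * (freq a b (q + 1) ^ (-β))⁻¹ * (freq a b (q + 1))⁻¹
      = freq a b q ^ (1 - β + 3 * α / 2) * freq a b (q + 1) ^ (β - 1) := by rw [← hB]; ring
    _ ≤ 1 := hq

end SixSix

/-! ## G₂ from Cor. 5.8 (`BDSV.correctorPartBound`) -/

section Assembly

/-- Integrals on `T³` (a probability space) of pointwise bounded functions: `|∫ f| ≤ B` if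
`|f| ≤ B` pointwise. [folklore] -/
theorem abs_integral_le_of_abs_le {f : UnitAddTorus (Fin 3) → ℝ} {B : ℝ} (h : ∀ x, |f x| ≤ B) :
    |∫ x, f x| ≤ B := by
  have h' : ∀ x, ‖f x‖ ≤ B := fun x => by rw [Real.norm_eq_abs]; exact h x
  have := norm_integral_le_of_norm_le_const (μ := (volume : Measure (UnitAddTorus (Fin 3))))
    (Filter.Eventually.of_forall h')
  rw [Real.norm_eq_abs] at this
  simpa using this

/-- **The corrector terms from Cor. 5.8** (BDSV, proof of Prop. 6.2, second estimate): the
named fact G₂ (`BDSV.energy_correctorTerm`: `|∫ 2w_o·w_c + |w_c|²| ≲ δ_{q+1} ℓ⁻¹ λ_{q+1}⁻¹`)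
follows from the corrector bound of Cor. 5.8 (`BDSV.correctorPartBound`, whose sup half
`‖w_c‖₀ ≤ C δ_{q+1}^{1/2} ℓ⁻¹ λ_{q+1}⁻¹` is used) and the proved sup bound on `w_o`: pointwise
`|2⟪w_o,w_c⟫ + |w_c|²| ≤ 2‖w_o‖‖w_c‖ + ‖w_c‖² ≤ (2KC + C²) δ_{q+1} ℓ⁻¹ λ_{q+1}⁻¹` using (6.6)
`ℓ⁻¹λ_{q+1}⁻¹ ≤ 1` on the square, then integrate (`T³` has measure one). Thresholds:
`α < min(α₀′, βb(b-1), (1-β)(b-1)/3)`, `a` beyond those of Cor. 5.8, of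
`4δ_{q+2} ≤ δ_{q+1}λ_q^{-α}` and of (6.6). [cite: BuckmasterEtAl2018, Prop. 6.2 (proof, second estimate)] -/
theorem energy_correctorTerm_of_correctorPartBound (h : correctorPartBound) :
    energy_correctorTerm := by
  intro 𝔚 c₀ hc₀ Cη β hβ hβ' b hb hb'
  obtain ⟨α₁, hα₁, h1⟩ := h 𝔚 c₀ hc₀ Cη β hβ hβ' b hb hb'
  have hb0 : (0 : ℝ) < b := by linarith
  have hb1 : (0 : ℝ) < b - 1 := by linarith
  have h1β : (0 : ℝ) < 1 - β := by linarith
  refine ⟨min α₁ (min (β * b * (b - 1)) ((1 - β) * (b - 1) / 3)),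
    lt_min hα₁ (lt_min (mul_pos (mul_pos hβ hb0) hb1) (div_pos (mul_pos h1β hb1) (by norm_num))),
    fun α hα hαlt => ?_⟩
  have hα1 : α < α₁ := lt_of_lt_of_le hαlt (min_le_left _ _)
  have hαb : α < 2 * β * b * (b - 1) := by
    have := lt_of_lt_of_le hαlt ((min_le_right _ _).trans (min_le_left _ _))
    nlinarith [mul_pos hβ hb0]
  have hα66 : 3 * α < 2 * (1 - β) * (b - 1) := by
    have := lt_of_lt_of_le hαlt ((min_le_right _ _).trans (min_le_right _ _))
    nlinarith [mul_pos h1β hb1]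
  obtain ⟨N₁, h1⟩ := h1 α hα hα1
  refine ⟨N₁, fun Cin C₀ => ?_⟩
  obtain ⟨C₁, a₁, ha₁, h1⟩ := h1 Cin C₀
  set Cp : ℝ := max Cin 0 with hCp
  have hCp0 : 0 ≤ Cp := le_max_right _ _
  obtain ⟨KW, hKW0, hKW⟩ := 𝔚.exists_bound_W
    (isCompact_closedBall (0 : Matrix (Fin 3) (Fin 3) ℝ) (9 * Real.exp (8 * Cp) * (1 + 8 * Cp)))
  set Ko : ℝ := 18 * Real.exp (8 * Cp) * KW / Real.sqrt c₀ with hKo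
  have hKo0 : 0 ≤ Ko := by rw [hKo]; positivity
  set C₁p : ℝ := max C₁ 0 with hC₁p
  have hC₁p0 : 0 ≤ C₁p := le_max_right _ _
  obtain ⟨a₄, ha₄, h4⟩ := exists_threshold_four_amp hb hαb
  obtain ⟨a₆, ha₆, h66⟩ := exists_threshold_mollScale_inv_mul_freq_inv_le_one hb.le hα66
  refine ⟨2 * Ko * C₁p + C₁p ^ 2, max a₁ (max a₄ a₆), lt_max_of_lt_left ha₁,
    fun a ha S H 𝒟 t ht => ?_⟩
  have haa₁ : a₁ ≤ a := (le_max_left _ _).trans ha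
  have haa₄ : a₄ ≤ a := ((le_max_left _ _).trans (le_max_right _ _)).trans ha
  have haa₆ : a₆ ≤ a := ((le_max_right _ _).trans (le_max_right _ _)).trans ha
  have ha1 : (1 : ℝ) ≤ a := ha₁.le.trans haa₁
  -- the scales
  set s : ℝ := Real.sqrt (amp β a b (S.q + 1)) with hs
  set L : ℝ := (mollScale β α a b S.q)⁻¹ * (freq a b (S.q + 1))⁻¹ with hL
  have hs0 : 0 ≤ s := Real.sqrt_nonneg _
  have hL0 : 0 ≤ L := mul_nonneg (inv_nonneg.2 (mollScale_pos ha1 _).le)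
    (inv_nonneg.2 (freq_pos ha1 _).le)
  have hL1 : L ≤ 1 := h66 a haa₆ S.q
  have hss : s * s = amp β a b (S.q + 1) := Real.mul_self_sqrt (amp_pos ha1 _).le
  -- sup bounds on `w_o` and `w_c`
  have H' : PerturbationHypotheses ⟨β, α, a, b⟩ S N₁ Cp C₀ := H.mono_const ha1 (le_max_left _ _)
  have hwo : ∀ x, ‖principalPart ⟨β, α, a, b⟩ S 𝔚 𝒟.cut.η 𝒟.D t x‖ ≤ Ko * s := fun x =>
    𝒟.norm_principalPart_le H' 𝔚 hc₀ hCp0 ha1 hb.le hβ.le hα.le (h4 a haa₄ S.q) hKW0 hKW ht x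
  have hwc : ∀ x, ‖correctorPart ⟨β, α, a, b⟩ S 𝔚 𝒟.cut.η 𝒟.D t x‖ ≤ C₁p * (s * L) := fun x =>
    calc ‖correctorPart ⟨β, α, a, b⟩ S 𝔚 𝒟.cut.η 𝒟.D t x‖
        ≤ C₁ * (s * (mollScale β α a b S.q)⁻¹ * (freq a b (S.q + 1))⁻¹) :=
          (h1 a haa₁ S H 𝒟).1 t ht x
      _ = C₁ * (s * L) := by rw [hL]; ring
      _ ≤ C₁p * (s * L) := mul_le_mul_of_nonneg_right (le_max_left _ _) (mul_nonneg hs0 hL0)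
  -- pointwise bound on the integrand
  have hpt : ∀ x, |2 * ⟪principalPart ⟨β, α, a, b⟩ S 𝔚 𝒟.cut.η 𝒟.D t x,
      correctorPart ⟨β, α, a, b⟩ S 𝔚 𝒟.cut.η 𝒟.D t x⟫_ℝ +
        ‖correctorPart ⟨β, α, a, b⟩ S 𝔚 𝒟.cut.η 𝒟.D t x‖ ^ 2| ≤
      (2 * Ko * C₁p + C₁p ^ 2) * (amp β a b (S.q + 1) * L) := by
    intro x
    have ho := hwo x
    have hc := hwc x
    have hin := abs_real_inner_le_norm (principalPart ⟨β, α, a, b⟩ S 𝔚 𝒟.cut.η 𝒟.D t x)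
      (correctorPart ⟨β, α, a, b⟩ S 𝔚 𝒟.cut.η 𝒟.D t x)
    have hprod : ‖principalPart ⟨β, α, a, b⟩ S 𝔚 𝒟.cut.η 𝒟.D t x‖ *
        ‖correctorPart ⟨β, α, a, b⟩ S 𝔚 𝒟.cut.η 𝒟.D t x‖ ≤ Ko * s * (C₁p * (s * L)) :=
      mul_le_mul ho hc (norm_nonneg _) (mul_nonneg hKo0 hs0)
    have hsq : ‖correctorPart ⟨β, α, a, b⟩ S 𝔚 𝒟.cut.η 𝒟.D t x‖ ^ 2 ≤ (C₁p * (s * L)) ^ 2 :=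
      pow_le_pow_left₀ (norm_nonneg _) hc 2
    have hsq' : (C₁p * (s * L)) ^ 2 ≤ C₁p ^ 2 * (amp β a b (S.q + 1) * L) := by
      have e : (C₁p * (s * L)) ^ 2 = C₁p ^ 2 * (amp β a b (S.q + 1) * L) * L := by
        rw [← hss]; ring
      rw [e]
      exact mul_le_of_le_one_right
        (mul_nonneg (sq_nonneg _) (mul_nonneg (amp_pos ha1 _).le hL0)) hL1
    have hp2 : Ko * s * (C₁p * (s * L)) = Ko * C₁p * (amp β a b (S.q + 1) * L) := by
      rw [← hss]; ring
    rw [abs_le]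
    obtain ⟨hin1, hin2⟩ := abs_le.mp hin
    constructor <;> nlinarith [sq_nonneg ‖correctorPart ⟨β, α, a, b⟩ S 𝔚 𝒟.cut.η 𝒟.D t x‖]
  -- integrate
  have hI := abs_integral_le_of_abs_le hpt
  calc |∫ x, (2 * ⟪principalPart ⟨β, α, a, b⟩ S 𝔚 𝒟.cut.η 𝒟.D t x,
        correctorPart ⟨β, α, a, b⟩ S 𝔚 𝒟.cut.η 𝒟.D t x⟫_ℝ +
          ‖correctorPart ⟨β, α, a, b⟩ S 𝔚 𝒟.cut.η 𝒟.D t x‖ ^ 2)|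
      ≤ (2 * Ko * C₁p + C₁p ^ 2) * (amp β a b (S.q + 1) * L) := hI
    _ = (2 * Ko * C₁p + C₁p ^ 2) * (amp β a b (S.q + 1) * (mollScale β α a b S.q)⁻¹ *
        (freq a b (S.q + 1))⁻¹) := by rw [hL]; ring

end Assembly

end BDSV

end Literature.Analysis.FluidPDE
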